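import Literature.NumberTheory.GaloisRepresentations.CentralInvolutionLayerProofs
import Literature.NumberTheory.GaloisRepresentations.ArtinConductorInductionLocal
import Literature.NumberTheory.GaloisRepresentations.CubicEisensteinRamificationProofs
import HarnessLib

/-!
# An intermediate field of a finite layer `E/K` of `K̄` as a base: transport of the ramification
# filtration, and the inertia field `E^{Q₀}` (Serre, *Local Fields*, Ch. I §7, Ch. IV §1)

Definitions file (two pieces of genuine data, plus their API; no named facts, no `sorry`) in topic
`NumberTheory/GaloisRepresentations`, landed by the seat of
`WeierstrassCurve.conductorNatOf_geomPoints_eq_conductorNorm_of_isElliptic` (Ogg–Saito at `2` over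
`ℚ`).  Purpose: the Galois side of Ogg's formula above `2` is read on `E = K(x(E[3]))`
(`ThreeTorsionCentralInvolutionSwanProofs`, `ThreeTorsionTwoBreakSwanProofs`: the inertia
filtration `Q_i` of `Gal(E/K)` at `𝔓 ∩ E`), and the generic tools that compute filtrations —
Serre's Prop. IV.3 through quotients (`IndexFormula_holds`, `lowerIndex_add_eq_of_biquadratic`),
Eisenstein quadratics (`QuadraticEisensteinRamificationProofs`) — live in the setting
`(R, K', L)` of a Galois extension *of the base*.  For `E = ℚ(ζ₃, ∛Δ, U₀, U₁, U₂)` the relevant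
structure (biquadratic, with normal quadratic layers) only appears over a larger base
`K' ⊇ K(ζ₃, ∛Δ)`, which is not a quotient situation over `K`.  This file provides the change of
base to **any intermediate field `K ≤ T ≤ E`**, and singles out the **inertia field
`T₀ = E^{Q₀}`**, over which `E` is totally ramified while nothing new ramifies below:

* `integralClosureIntermediateEquiv T : integralClosure (𝓞 T) E ≃+* integralClosure (𝓞 K) E` —
  **the identity of `E`** (both subrings consist of the algebraic integers of `E`,
  `integralClosure_toSubring_eq_of_intermediate`), and
  `galIntermediateHom T : Gal(E/T) →* Gal(E/K)` — restriction of scalars (injective, with range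
  the fixing group of `T`, `range_galIntermediateHom`), **equivariant**
  (`integralClosureIntermediateEquiv_smul`);
* at an ideal `𝔓_E` of `integralClosure (𝓞 K) E` and its copy
  `𝔓' = e⁻¹ 𝔓_E ⊆ integralClosure (𝓞 T) E`: **`s ∈ Gal(E/T)_i ↔ s ∈ Gal(E/K)_i`**,
  **`i_{Gal(E/T)}(s) = i_{Gal(E/K)}(s)`**, **`#Gal(E/T)_i = #(Gal(E/K)_i ∩ Gal(E/T))`**
  (`= #Gal(E/K)_i` when the inertia group fixes `T`) — Serre IV §1 Prop. 2 (the filtration of a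
  subgroup is the induced one), via the tree's transport lemmas
  `ramificationSubgroup_comap_eq_comap_of_equivariant` etc. (`ArtinConductorInductionLocal`);
  `𝔓'` is maximal, non-zero, with finite residue ring and separable residue extension over
  `𝓞 T`, and `v_{𝔓'}(x) = v_{𝔓_E}(e x)` (`ord_comap_intermediate`); `T` is a number field;
* for `T₀ = E^{Q₀}` (`IntermediateField.fixedField` of the inertia group, fixing group `Q₀`):
  **`Gal(E/T₀)₀ = Gal(E/T₀)`** (total ramification), **`#Gal(E/T₀)_i = #Q_i`** for all `i`,
  **`e(𝔓' | 𝔓' ∩ T₀) = #Q₀`** (`ramificationIdx'_comap_fixedField_eq_card`, Serre I §7 Cor. to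
  Prop. 21 over `T₀`), and **`v_{𝔓' ∩ T₀}(x) = v_{𝔓 ∩ K}(x)` for `x ∈ 𝓞 K`**
  (`ord_under_comap_fixedField_algebraMap`: `T₀/K` is unramified at `𝔓' ∩ T₀`, by comparing the
  two index formulas `e · v_𝔭 = v_𝔓`).  Above `2` over `ℚ` this says `v_{𝔭'}(2) = 1`: an
  Eisenstein polynomial at `2` stays Eisenstein over the inertia field, so the quadratic layers
  of `E/T₀` are computed by `QuadraticEisensteinRamificationProofs` and assembled by
  `lowerIndex_add_eq_of_biquadratic`, and the resulting `#Gal(E/T₀)_i` are the `#Q_i`.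

## References

* J.-P. Serre, *Local Fields*, GTM 67 (1979), Ch. I §7 (Prop. 20–22 and the Corollary to
  Prop. 21: decomposition and inertia fields, `e = #G₀`, `K_T/K` unramified), Ch. IV §1
  (Prop. 2: `H_i = G_i ∩ H`). [SerreLocalFields1979]
* J. Neukirch, *Algebraic Number Theory* (1999), Ch. I §9 (9.6)–(9.9) (Hilbert theory: inertia
  field, ramification indices in towers). [NeukirchANT1999]

## Design

`integralClosureIntermediateEquiv` is `RingEquiv.subringCongr` of the equality of subrings
(no choice); `galIntermediateHom` is `AlgEquiv.restrictScalars`; the equivariance is `rfl`.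
Everything else is a theorem.  The inertia field is not named: it appears as
`IntermediateField.fixedField (𝔓_E.ramificationSubgroup (E ≃ₐ[K] E) 0)`.  Instances on the
`𝓞 T`-side (`NumberField T`, maximality, finiteness, separability) are provided as theorems to
be introduced with `haveI`.  Namespace `Literature.NumberTheory.GaloisRepresentations`;
`noncomputable section`.  Axioms: `propext`, `Classical.choice`, `Quot.sound`.
-/

noncomputable section

open scoped Pointwise NumberField
open Field IsDedekindDomain Literature.NumberTheory.GaloisRepresentations

universe u

namespace Literature.NumberTheory.GaloisRepresentations

section IntermediateBase

variable {K : Type u} [Field K] [NumberField K]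
  {E : IntermediateField K (AlgebraicClosure K)} [FiniteDimensional K E]
  (T : IntermediateField K E)

omit [NumberField K] [FiniteDimensional K E] in
/-- An element of `E` is integral over `𝓞 T` iff it is integral over `𝓞 K` (both mean: integral
over `ℤ`). [folklore] -/
theorem isIntegral_ringOfIntegers_intermediate_iff (x : E) :
    IsIntegral (𝓞 T) x ↔ IsIntegral (𝓞 K) x := by
  haveI : IsScalarTower ℤ (𝓞 K) E := IsScalarTower.of_algebraMap_eq' (RingHom.ext_int _ _)
  haveI : IsScalarTower ℤ (𝓞 T) E := IsScalarTower.of_algebraMap_eq' (RingHom.ext_int _ _)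
  constructor
  · intro hx
    have h1 : IsIntegral ℤ x := isIntegral_trans (R := ℤ) x hx
    exact h1.tower_top
  · intro hx
    have h1 : IsIntegral ℤ x := isIntegral_trans (R := ℤ) x hx
    exact h1.tower_top

omit [NumberField K] [FiniteDimensional K E] in
/-- The two integral closures of `E` — over `𝓞 T` and over `𝓞 K` — have the same underlying
subring. [folklore] -/
theorem integralClosure_toSubring_eq_of_intermediate :
    (integralClosure (𝓞 T) E).toSubring = (integralClosure (𝓞 K) E).toSubring := by
  ext x
  change IsIntegral (𝓞 T) x ↔ IsIntegral (𝓞 K) x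
  exact isIntegral_ringOfIntegers_intermediate_iff T x

/-- **The identity of `E` as a ring isomorphism `integralClosure (𝓞 T) E ≃ integralClosure (𝓞 K) E`**
for an intermediate field `K ≤ T ≤ E`. [folklore] -/
def integralClosureIntermediateEquiv :
    integralClosure (𝓞 T) E ≃+* integralClosure (𝓞 K) E :=
  RingEquiv.subringCongr (integralClosure_toSubring_eq_of_intermediate T)

omit [NumberField K] [FiniteDimensional K E] in
/-- The identity on underlying elements of `E`. [folklore] -/
@[simp] theorem coe_integralClosureIntermediateEquiv (x : integralClosure (𝓞 T) E) :
    ((integralClosureIntermediateEquiv T x : integralClosure (𝓞 K) E) : E) = (x : E) := rfl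

/-- **`Gal(E/T) → Gal(E/K)`** (restriction of scalars), as a group homomorphism. [folklore] -/
def galIntermediateHom : (E ≃ₐ[T] E) →* (E ≃ₐ[K] E) where
  toFun g := g.restrictScalars K
  map_one' := rfl
  map_mul' _ _ := rfl

omit [NumberField K] [FiniteDimensional K E] in
/-- Restriction of scalars does not change the underlying map. [folklore] -/
@[simp] theorem galIntermediateHom_apply (g : E ≃ₐ[T] E) (x : E) :
    galIntermediateHom T g x = g x := rfl

omit [NumberField K] [FiniteDimensional K E] in
/-- `Gal(E/T) → Gal(E/K)` is injective. [folklore] -/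
theorem galIntermediateHom_injective : Function.Injective (galIntermediateHom T) := by
  intro g h hgh
  apply AlgEquiv.ext
  intro x
  exact congrArg (fun f : E ≃ₐ[K] E => f x) hgh

omit [NumberField K] [FiniteDimensional K E] in
/-- The range of `Gal(E/T) → Gal(E/K)` is the fixing subgroup of `T`. [folklore] -/
theorem range_galIntermediateHom : (galIntermediateHom T).range = T.fixingSubgroup := by
  ext σ
  rw [IntermediateField.mem_fixingSubgroup_iff, MonoidHom.mem_range]
  constructor
  · rintro ⟨g, rfl⟩ x hx
    rw [galIntermediateHom_apply]
    exact g.commutes ⟨x, hx⟩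
  · intro h
    refine ⟨{ σ with commutes' := fun t => h t t.2 }, ?_⟩
    ext x
    rfl

omit [NumberField K] [FiniteDimensional K E] in
/-- Equivariance of the identity `integralClosure (𝓞 T) E ≃ integralClosure (𝓞 K) E` for
`Gal(E/T) → Gal(E/K)`. [folklore] -/
theorem integralClosureIntermediateEquiv_smul (g : E ≃ₐ[T] E) (x : integralClosure (𝓞 T) E) :
    integralClosureIntermediateEquiv T (g • x) = galIntermediateHom T g • integralClosureIntermediateEquiv T x := by
  apply Subtype.ext
  rfl

end IntermediateBase

end Literature.NumberTheory.GaloisRepresentations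

namespace Literature.NumberTheory.GaloisRepresentations

/-! ### Transport of the ramification filtration to an intermediate base field -/

section TransportAtPrime

variable {K : Type u} [Field K] [NumberField K]
  {E : IntermediateField K (AlgebraicClosure K)} [FiniteDimensional K E]
  (T : IntermediateField K E) (𝔓E : Ideal (integralClosure (𝓞 K) E))

/-- An intermediate field of a finite layer of `K̄/K` is a number field. [folklore] -/
theorem numberField_intermediate : NumberField T := by
  haveI : FiniteDimensional ℚ E := FiniteDimensional.trans ℚ K E
  haveI : FiniteDimensional ℚ T := FiniteDimensional.left ℚ T E
  exact NumberField.mk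

omit [NumberField K] [FiniteDimensional K E] in
/-- **`s ∈ Gal(E/T)_i ↔ s ∈ Gal(E/K)_i`** at `𝔓 ∩ E` (the filtration of a subgroup is the
restriction of the filtration, Serre IV §1 Prop. 2; here along the identity of `S_E`).
[cite: SerreLocalFields1979, Ch. IV §1 Prop. 2] -/
theorem mem_ramificationSubgroup_comap_intermediate_iff (s : E ≃ₐ[T] E) (i : ℕ) :
    s ∈ (𝔓E.comap (integralClosureIntermediateEquiv T : integralClosure (𝓞 T) E →+*
        integralClosure (𝓞 K) E)).ramificationSubgroup (E ≃ₐ[T] E) i ↔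
      galIntermediateHom T s ∈ 𝔓E.ramificationSubgroup (E ≃ₐ[K] E) i := by
  rw [ramificationSubgroup_comap_eq_comap_of_equivariant (galIntermediateHom T)
    (integralClosureIntermediateEquiv T) (integralClosureIntermediateEquiv_smul T) 𝔓E i,
    Subgroup.mem_comap]

omit [NumberField K] [FiniteDimensional K E] in
/-- **`i_{Gal(E/T)}(s) = i_{Gal(E/K)}(s)`** at `𝔓 ∩ E`. [cite: SerreLocalFields1979, Ch. IV §1 Prop. 2] -/
theorem lowerIndex_comap_intermediate (s : E ≃ₐ[T] E) :
    lowerIndex (𝔓E.comap (integralClosureIntermediateEquiv T : integralClosure (𝓞 T) E →+*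
        integralClosure (𝓞 K) E)) (E ≃ₐ[T] E) s =
      lowerIndex 𝔓E (E ≃ₐ[K] E) (galIntermediateHom T s) :=
  lowerIndex_comap_eq_of_equivariant (galIntermediateHom T) (integralClosureIntermediateEquiv T)
    (integralClosureIntermediateEquiv_smul T) 𝔓E s

omit [NumberField K] [FiniteDimensional K E] in
/-- **`#Gal(E/T)_i = #(Gal(E/K)_i ∩ Gal(E/T))`** at `𝔓 ∩ E`. [cite: SerreLocalFields1979, Ch. IV §1 Prop. 2] -/
theorem card_ramificationSubgroup_comap_intermediate (i : ℕ) :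
    Nat.card ((𝔓E.comap (integralClosureIntermediateEquiv T : integralClosure (𝓞 T) E →+*
        integralClosure (𝓞 K) E)).ramificationSubgroup (E ≃ₐ[T] E) i) =
      Nat.card ↥(𝔓E.ramificationSubgroup (E ≃ₐ[K] E) i ⊓ T.fixingSubgroup) := by
  rw [← range_galIntermediateHom T]
  exact card_ramificationSubgroup_comap_eq_of_equivariant (galIntermediateHom T)
    (galIntermediateHom_injective T) (integralClosureIntermediateEquiv T)
    (integralClosureIntermediateEquiv_smul T) 𝔓E i

omit [NumberField K] [FiniteDimensional K E] in
/-- If the inertia group of `𝔓 ∩ E` fixes `T`, then **`#Gal(E/T)_i = #Gal(E/K)_i`** for all `i`.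
[cite: SerreLocalFields1979, Ch. IV §1 Prop. 2] -/
theorem card_ramificationSubgroup_comap_intermediate_of_le
    (h : 𝔓E.ramificationSubgroup (E ≃ₐ[K] E) 0 ≤ T.fixingSubgroup) (i : ℕ) :
    Nat.card ((𝔓E.comap (integralClosureIntermediateEquiv T : integralClosure (𝓞 T) E →+*
        integralClosure (𝓞 K) E)).ramificationSubgroup (E ≃ₐ[T] E) i) =
      Nat.card (𝔓E.ramificationSubgroup (E ≃ₐ[K] E) i) := by
  rw [card_ramificationSubgroup_comap_intermediate,
    show 𝔓E.ramificationSubgroup (E ≃ₐ[K] E) i ⊓ T.fixingSubgroup =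
      𝔓E.ramificationSubgroup (E ≃ₐ[K] E) i from
      inf_eq_left.mpr (le_trans (𝔓E.ramificationSubgroup_antitone _ (Nat.zero_le i)) h)]

omit [NumberField K] [FiniteDimensional K E] in
/-- `𝔓 ∩ E` stays maximal along the identity. [folklore] -/
theorem isMaximal_comap_intermediate [𝔓E.IsMaximal] :
    (𝔓E.comap (integralClosureIntermediateEquiv T : integralClosure (𝓞 T) E →+*
        integralClosure (𝓞 K) E)).IsMaximal :=
  Ideal.comap_isMaximal_of_surjective _ (integralClosureIntermediateEquiv T).surjective

omit [NumberField K] [FiniteDimensional K E] in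
/-- `𝔓 ∩ E ≠ 0` along the identity. [folklore] -/
theorem comap_intermediate_ne_bot (h : 𝔓E ≠ ⊥) :
    𝔓E.comap (integralClosureIntermediateEquiv T : integralClosure (𝓞 T) E →+*
        integralClosure (𝓞 K) E) ≠ ⊥ := by
  intro h0
  apply h
  rw [eq_bot_iff]
  intro x hx
  have : (integralClosureIntermediateEquiv T).symm x ∈ 𝔓E.comap
      (integralClosureIntermediateEquiv T : integralClosure (𝓞 T) E →+* integralClosure (𝓞 K) E) := by
    rw [Ideal.mem_comap]
    simpa using hx
  rw [h0, Ideal.mem_bot] at this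
  have := congrArg (integralClosureIntermediateEquiv T) this
  simpa using this

omit [NumberField K] [FiniteDimensional K E] in
/-- The residue ring of `𝔓 ∩ E` is finite along the identity. [folklore] -/
theorem finite_quotient_comap_intermediate [Finite (integralClosure (𝓞 K) E ⧸ 𝔓E)] :
    Finite (integralClosure (𝓞 T) E ⧸ 𝔓E.comap (integralClosureIntermediateEquiv T :
      integralClosure (𝓞 T) E →+* integralClosure (𝓞 K) E)) :=
  Finite.of_injective _ (Ideal.quotientMap_injective (I := 𝔓E)
    (f := (integralClosureIntermediateEquiv T : integralClosure (𝓞 T) E →+* integralClosure (𝓞 K) E)))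

set_option synthInstance.maxHeartbeats 400000 in
set_option maxHeartbeats 1600000 in
/-- The residue extension of `𝔓 ∩ E` over `𝓞 T` is separable (finite residue fields).
[folklore] -/
theorem isSeparable_residue_comap_intermediate [𝔓E.IsMaximal]
    [Finite (integralClosure (𝓞 K) E ⧸ 𝔓E)] (h0 : 𝔓E ≠ ⊥) :
    Algebra.IsSeparable (𝓞 T ⧸ (𝔓E.comap (integralClosureIntermediateEquiv T :
        integralClosure (𝓞 T) E →+* integralClosure (𝓞 K) E)).under (𝓞 T))
      (integralClosure (𝓞 T) E ⧸ 𝔓E.comap (integralClosureIntermediateEquiv T :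
        integralClosure (𝓞 T) E →+* integralClosure (𝓞 K) E)) := by
  set 𝔓' := 𝔓E.comap (integralClosureIntermediateEquiv T :
        integralClosure (𝓞 T) E →+* integralClosure (𝓞 K) E) with h𝔓'
  haveI : 𝔓'.IsMaximal := isMaximal_comap_intermediate T 𝔓E
  haveI : (𝔓'.under (𝓞 T)).IsMaximal := Ideal.IsMaximal.under (𝓞 T) 𝔓'
  letI : Field (𝓞 T ⧸ 𝔓'.under (𝓞 T)) := Ideal.Quotient.field _
  letI : Field (integralClosure (𝓞 T) E ⧸ 𝔓') := Ideal.Quotient.field _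
  haveI : Finite (integralClosure (𝓞 T) E ⧸ 𝔓') := finite_quotient_comap_intermediate T 𝔓E
  haveI hT : NumberField T := numberField_intermediate T
  have hne : 𝔓' ≠ ⊥ := comap_intermediate_ne_bot T 𝔓E h0
  have hune : 𝔓'.under (𝓞 T) ≠ ⊥ := Ideal.IsIntegral.comap_ne_bot _ hne
  haveI : Finite (𝓞 T ⧸ 𝔓'.under (𝓞 T)) := Ideal.finiteQuotientOfFreeOfNeBot _ hune
  haveI : PerfectField (𝓞 T ⧸ 𝔓'.under (𝓞 T)) := PerfectField.ofFinite
  haveI : Algebra.IsAlgebraic (𝓞 T ⧸ 𝔓'.under (𝓞 T)) (integralClosure (𝓞 T) E ⧸ 𝔓') :=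
    Algebra.IsIntegral.isAlgebraic
  exact Algebra.IsAlgebraic.isSeparable_of_perfectField

/-- Transport of `v_𝔓` along the identity: `v_{e⁻¹𝔓}(x) = v_𝔓(e x)`. [folklore] -/
theorem ord_comap_intermediate (x : integralClosure (𝓞 T) E) :
    ord (𝔓E.comap (integralClosureIntermediateEquiv T : integralClosure (𝓞 T) E →+*
        integralClosure (𝓞 K) E)) x = ord 𝔓E (integralClosureIntermediateEquiv T x) := by
  haveI : IsDedekindDomain (integralClosure (𝓞 K) E) :=
    integralClosure.isDedekindDomain (𝓞 K) K E
  haveI hT : NumberField T := numberField_intermediate T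
  haveI : IsDedekindDomain (integralClosure (𝓞 T) E) :=
    integralClosure.isDedekindDomain (𝓞 T) T E
  set e := integralClosureIntermediateEquiv T with he
  have hJ : ((𝔓E.comap (e : integralClosure (𝓞 T) E →+* integralClosure (𝓞 K) E)).map
      (e : integralClosure (𝓞 T) E →+* integralClosure (𝓞 K) E)) = 𝔓E :=
    Ideal.map_comap_of_surjective _ e.surjective _
  have hmem : ∀ n : ℕ, (n : ℕ∞) ≤ ord (𝔓E.comap (e : integralClosure (𝓞 T) E →+*
      integralClosure (𝓞 K) E)) x ↔ (n : ℕ∞) ≤ ord 𝔓E (e x) := by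
    intro n
    rw [← mem_pow_iff_le_ord, ← mem_pow_iff_le_ord]
    conv_rhs => rw [← hJ, ← Ideal.map_pow, mem_map_ringEquiv_iff, RingEquiv.symm_apply_apply]
  apply le_antisymm
  · rw [← ENat.forall_natCast_le_iff_le]
    intro n hn
    exact (hmem n).mp hn
  · rw [← ENat.forall_natCast_le_iff_le]
    intro n hn
    exact (hmem n).mpr hn

end TransportAtPrime

/-! ### The inertia field `T₀ = E^{Q₀}` of `𝔓 ∩ E` as a base: total ramification, no new
ramification below -/

section InertiaField

variable {K : Type u} [Field K] [NumberField K]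
  {E : IntermediateField K (AlgebraicClosure K)} [FiniteDimensional K E] [IsGalois K E]
  (𝔓E : Ideal (integralClosure (𝓞 K) E))

omit [NumberField K] [IsGalois K E] in
/-- The fixing group of the inertia field `E^{Q₀}` is `Q₀` (Galois correspondence).
[cite: SerreLocalFields1979, Ch. I §7 Prop. 22 and Cor. (the inertia field)] -/
theorem fixingSubgroup_fixedField_inertia :
    (IntermediateField.fixedField (𝔓E.ramificationSubgroup (E ≃ₐ[K] E) 0)).fixingSubgroup =
      𝔓E.ramificationSubgroup (E ≃ₐ[K] E) 0 :=
  IntermediateField.fixingSubgroup_fixedField _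

omit [NumberField K] [IsGalois K E] in
/-- **`E/E^{Q₀}` is totally ramified at `𝔓 ∩ E`**: every element of `Gal(E/E^{Q₀})` lies in the
inertia group of `𝔓 ∩ E` (transported to the base `E^{Q₀}`).
[cite: SerreLocalFields1979, Ch. I §7 Prop. 22 and Cor. (the inertia field)] -/
theorem ramificationSubgroup_zero_comap_fixedField_eq_top :
    (𝔓E.comap (integralClosureIntermediateEquiv
        (IntermediateField.fixedField (𝔓E.ramificationSubgroup (E ≃ₐ[K] E) 0)) :
        integralClosure (𝓞 (IntermediateField.fixedField (𝔓E.ramificationSubgroup (E ≃ₐ[K] E) 0))) E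
          →+* integralClosure (𝓞 K) E)).ramificationSubgroup
        (E ≃ₐ[IntermediateField.fixedField (𝔓E.ramificationSubgroup (E ≃ₐ[K] E) 0)] E) 0 = ⊤ := by
  set T₀ := IntermediateField.fixedField (𝔓E.ramificationSubgroup (E ≃ₐ[K] E) 0) with hT₀
  ext s
  simp only [Subgroup.mem_top, iff_true]
  rw [mem_ramificationSubgroup_comap_intermediate_iff]
  have hmem : galIntermediateHom T₀ s ∈ (galIntermediateHom T₀).range := ⟨s, rfl⟩
  rw [range_galIntermediateHom] at hmem
  have hfix : T₀.fixingSubgroup = 𝔓E.ramificationSubgroup (E ≃ₐ[K] E) 0 :=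
    fixingSubgroup_fixedField_inertia 𝔓E
  exact hfix ▸ hmem

omit [NumberField K] [IsGalois K E] in
/-- **`#Gal(E/E^{Q₀})_i = #Q_i`** for all `i` (the filtration above the inertia field is the whole
inertia filtration).  [cite: SerreLocalFields1979, Ch. IV §1 Prop. 2] -/
theorem card_ramificationSubgroup_comap_fixedField (i : ℕ) :
    Nat.card ((𝔓E.comap (integralClosureIntermediateEquiv
        (IntermediateField.fixedField (𝔓E.ramificationSubgroup (E ≃ₐ[K] E) 0)) :
        integralClosure (𝓞 (IntermediateField.fixedField (𝔓E.ramificationSubgroup (E ≃ₐ[K] E) 0))) E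
          →+* integralClosure (𝓞 K) E)).ramificationSubgroup
        (E ≃ₐ[IntermediateField.fixedField (𝔓E.ramificationSubgroup (E ≃ₐ[K] E) 0)] E) i) =
      Nat.card (𝔓E.ramificationSubgroup (E ≃ₐ[K] E) i) :=
  card_ramificationSubgroup_comap_intermediate_of_le _ 𝔓E
    (by rw [fixingSubgroup_fixedField_inertia]) i

set_option synthInstance.maxHeartbeats 400000 in
set_option maxHeartbeats 1600000 in
/-- **`e(𝔓' | 𝔓' ∩ E^{Q₀}) = #Q₀`** for the prime `𝔓'` of `E` over its inertia field: the
ramification index over the inertia field is the order of the inertia group (Serre I §7 Cor. to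
Prop. 21 for the Galois extension `E/E^{Q₀}`, whose inertia group is all of `Gal(E/E^{Q₀}) ≅ Q₀`).
[cite: SerreLocalFields1979, Ch. I §7 Cor. to Prop. 21 and Prop. 22] -/
theorem ramificationIdx'_comap_fixedField_eq_card [𝔓E.IsMaximal]
    [Finite (integralClosure (𝓞 K) E ⧸ 𝔓E)] (h0 : 𝔓E ≠ ⊥) :
    ((𝔓E.comap (integralClosureIntermediateEquiv
        (IntermediateField.fixedField (𝔓E.ramificationSubgroup (E ≃ₐ[K] E) 0)) :
        integralClosure (𝓞 (IntermediateField.fixedField (𝔓E.ramificationSubgroup (E ≃ₐ[K] E) 0))) E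
          →+* integralClosure (𝓞 K) E)).under
        (𝓞 (IntermediateField.fixedField (𝔓E.ramificationSubgroup (E ≃ₐ[K] E) 0)))).ramificationIdx'
      (𝔓E.comap (integralClosureIntermediateEquiv
        (IntermediateField.fixedField (𝔓E.ramificationSubgroup (E ≃ₐ[K] E) 0)) :
        integralClosure (𝓞 (IntermediateField.fixedField (𝔓E.ramificationSubgroup (E ≃ₐ[K] E) 0))) E
          →+* integralClosure (𝓞 K) E)) =
      Nat.card (𝔓E.ramificationSubgroup (E ≃ₐ[K] E) 0) := by
  set T₀ := IntermediateField.fixedField (𝔓E.ramificationSubgroup (E ≃ₐ[K] E) 0) with hT₀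
  haveI hT : NumberField T₀ := numberField_intermediate T₀
  set 𝔓' := 𝔓E.comap (integralClosureIntermediateEquiv T₀ : integralClosure (𝓞 T₀) E →+*
    integralClosure (𝓞 K) E) with h𝔓'
  haveI : 𝔓'.IsMaximal := isMaximal_comap_intermediate T₀ 𝔓E
  haveI := isSeparable_residue_comap_intermediate T₀ 𝔓E h0
  have hne : 𝔓' ≠ ⊥ := comap_intermediate_ne_bot T₀ 𝔓E h0
  rw [ramificationIdx'_under_base_eq_card_inertia (K := T₀) 𝔓' hne,
    ← Ideal.ramificationSubgroup_zero, h𝔓', hT₀, card_ramificationSubgroup_comap_fixedField 𝔓E 0]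

set_option synthInstance.maxHeartbeats 400000 in
set_option maxHeartbeats 1600000 in
/-- **The inertia field is unramified below**: for `x ∈ 𝓞 K`,
`v_{𝔓' ∩ E^{Q₀}}(x) = v_{𝔓 ∩ K}(x)` — the prime of the inertia field `E^{Q₀}` below `𝔓'` has
ramification index `1` over `𝔓 ∩ K` (`e(𝔓'|𝔭') = #Q₀ = e(𝔓 ∩ E | 𝔓 ∩ K)` and multiplicativity:
`e(𝔓'|𝔭') v_{𝔭'}(x) = v_{𝔓'}(x) = v_{𝔓 ∩ E}(x) = e(𝔓 ∩ E|𝔭) v_𝔭(x)`).  In particular, above `2`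
over `ℚ`, `v_{𝔭'}(2) = 1`: Eisenstein data over `ℤ₂` stay Eisenstein over the inertia field.
[cite: SerreLocalFields1979, Ch. I §7 Prop. 22 and its Corollary (K_T/K unramified)] -/
theorem ord_under_comap_fixedField_algebraMap [𝔓E.IsMaximal]
    [Finite (integralClosure (𝓞 K) E ⧸ 𝔓E)]
    [Algebra.IsSeparable ((𝓞 K) ⧸ 𝔓E.under (𝓞 K)) (integralClosure (𝓞 K) E ⧸ 𝔓E)]
    (h0 : 𝔓E ≠ ⊥) (x : 𝓞 K) :
    ord ((𝔓E.comap (integralClosureIntermediateEquiv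
        (IntermediateField.fixedField (𝔓E.ramificationSubgroup (E ≃ₐ[K] E) 0)) :
        integralClosure (𝓞 (IntermediateField.fixedField (𝔓E.ramificationSubgroup (E ≃ₐ[K] E) 0))) E
          →+* integralClosure (𝓞 K) E)).under
        (𝓞 (IntermediateField.fixedField (𝔓E.ramificationSubgroup (E ≃ₐ[K] E) 0))))
      (algebraMap (𝓞 K) (𝓞 (IntermediateField.fixedField (𝔓E.ramificationSubgroup (E ≃ₐ[K] E) 0))) x)
      = ord (𝔓E.under (𝓞 K)) x := by
  set T₀ := IntermediateField.fixedField (𝔓E.ramificationSubgroup (E ≃ₐ[K] E) 0) with hT₀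
  haveI hT : NumberField T₀ := numberField_intermediate T₀
  set e := integralClosureIntermediateEquiv T₀ with hedef
  set 𝔓' := 𝔓E.comap (e : integralClosure (𝓞 T₀) E →+* integralClosure (𝓞 K) E) with h𝔓'
  haveI : 𝔓'.IsMaximal := isMaximal_comap_intermediate T₀ 𝔓E
  haveI := isSeparable_residue_comap_intermediate T₀ 𝔓E h0
  have hne : 𝔓' ≠ ⊥ := comap_intermediate_ne_bot T₀ 𝔓E h0
  haveI : IsDedekindDomain (integralClosure (𝓞 K) E) :=
    integralClosure.isDedekindDomain (𝓞 K) K E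
  set n := Nat.card (𝔓E.ramificationSubgroup (E ≃ₐ[K] E) 0) with hn
  have hnpos : 0 < n := Nat.card_pos
  set a := algebraMap (𝓞 K) (𝓞 T₀) x with ha
  -- the two index formulas
  have h1 := ord_algebraMap (K := T₀) 𝔓' hne a
  have h2 := ord_algebraMap (K := K) 𝔓E h0 x
  have he' : (𝔓'.under (𝓞 T₀)).ramificationIdx' 𝔓' = n :=
    ramificationIdx'_comap_fixedField_eq_card 𝔓E h0
  have he : (𝔓E.under (𝓞 K)).ramificationIdx' 𝔓E = n := by
    rw [ramificationIdx'_under_base_eq_card_inertia (K := K) 𝔓E h0, ← Ideal.ramificationSubgroup_zero]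
  -- the same element of `E`
  have hlink : ord 𝔓' (algebraMap (𝓞 T₀) (integralClosure (𝓞 T₀) E) a) =
      ord 𝔓E (algebraMap (𝓞 K) (integralClosure (𝓞 K) E) x) := by
    rw [h𝔓', ord_comap_intermediate]
    congr 1
  rw [he'] at h1
  rw [he] at h2
  rw [hlink, h2] at h1
  -- cancel `n`
  by_cases hx : x = 0
  · subst hx
    rw [ha, map_zero, ord_zero, ord_zero]
  have hp : 𝔓E.under (𝓞 K) ≠ ⊥ := Ideal.IsIntegral.comap_ne_bot _ h0
  haveI : (𝔓E.under (𝓞 K)).IsPrime := Ideal.IsPrime.under (𝓞 K) 𝔓E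
  obtain ⟨m, hm⟩ := exists_ord_eq_natCast (𝔓E.under (𝓞 K)) hp hx
  rw [hm] at h1 ⊢
  have hfin : ord (𝔓'.under (𝓞 T₀)) a ≠ ⊤ := by
    intro htop
    rw [htop, ENat.mul_top (by exact_mod_cast hnpos.ne')] at h1
    exact ENat.coe_ne_top (n * m) (by push_cast; exact h1)
  obtain ⟨m', hm'⟩ := ENat.ne_top_iff_exists.mp hfin
  rw [← hm'] at h1 ⊢
  have : n * m = n * m' := by exact_mod_cast h1
  have : m = m' := Nat.eq_of_mul_eq_mul_left hnpos this
  rw [this]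

end InertiaField

end Literature.NumberTheory.GaloisRepresentations
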